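import Mathlib.Algebra.Order.Antidiag.Finsupp
import Mathlib.RingTheory.MvPolynomial.Homogeneous
import Literature.Computability.AlgebraicComplexity.DeterminantalComplexityProofs
import HarnessLib

/-!
# Uniform universality of the determinant: a bound on `dc` depending only on the support
# (Ikenmeyer–Panova 2017, Lemma 2.7: `dcmax(m)` is finite)

Sibling proofs file of `Literature/Computability/AlgebraicComplexity/DeterminantalComplexity.lean`
(theorems only). C. Ikenmeyer, G. Panova, *Rectangular Kronecker coefficients and plethysms in
geometric complexity theory*, Adv. Math. 319 (2017) 40–66 = arXiv:1512.03798, Lemma 2.7 (held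
arXiv text: Lemma 14): "Fix `m ∈ ℕ`. There is a number `dcmax(m) ∈ ℕ` such that for all
`f ∈ V_m` we have `dc(f) ≤ dcmax(m)`" (`V_m = Sym^m ℂ^{m²}`), proved in print from Valiant's
universality ("if `f` has `r` monomials, then `dc(f) ≤ rm`"). The tree's discharge of Valiant's
universality (`exists_hasDetRepr_holds`, file `DeterminantalComplexityProofs`) asserts existence
only and does not track the size of the representation, so the uniformity is obtained here by the
generic-polynomial device: the polynomial `F_S = ∑_{e ∈ S} Y_e X^e` in the variables `X` and one
new variable `Y_e` per monomial `e ∈ S` has SOME affine determinantal representation, of size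
`C(S)` say, and every `f` with support in `S` is the specialisation `Y_e ↦ coeff_e f` of `F_S`,
which keeps the entries affine (`HasDetRepr.totalDegree_aeval_le_of_le_one`) and commutes with the
determinant (`AlgHom.map_det`). Hence `dc f ≤ C(S)` for all `f` supported in `S`
(`exists_forall_hasDetRepr_of_support_subset`), in particular for all forms of a fixed degree in
finitely many variables (`exists_forall_determinantalComplexity_le_of_isHomogeneous`, IP's
Lemma 2.7 for every finite set of variables and every commutative ring of coefficients). The
explicit value `dcmax(m) ≤ binom(m+m²-1, m)·m` of the printed proof is not asserted.

## References

* C. Ikenmeyer, G. Panova, Adv. Math. 319 (2017) = arXiv:1512.03798, §2.2, Lemma 2.7 (held: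
  Lemma 14). [key `IkenmeyerPanova2017`]
* L. G. Valiant, *Completeness classes in algebra*, STOC 1979, §2 (universality of the
  determinant). [key `ValiantSTOC1979`]
-/

namespace Literature.Computability.AlgebraicComplexity

open MvPolynomial

section Uniform

variable {k : Type*} [CommRing k] {σ : Type*}

/-- A polynomial whose support lies in the finset `S` is the sum over `S` of its monomials.
[folklore] -/
theorem eq_sum_monomial_coeff_of_support_subset {S : Finset (σ →₀ ℕ)} {f : MvPolynomial σ k}
    (hf : f.support ⊆ S) : f = ∑ e ∈ S, monomial e (coeff e f) := by
  classical
  conv_lhs => rw [f.as_sum]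
  refine Finset.sum_subset hf fun e _ he => ?_
  rw [notMem_support_iff.1 he, map_zero]

/-- **Uniform universality over a fixed support** (the device behind IP Lemma 2.7): for every
finite set `S` of monomials there is a size `C` such that EVERY polynomial with support in `S`
(over any commutative ring `k`) is the determinant of a `C × C` matrix of affine linear forms.
Proof: Valiant's universality (`exists_hasDetRepr_holds`) for the generic polynomial
`∑_{e ∈ S} Y_e X^e` over `k[X, Y]`, then specialise `Y_e ↦ coeff_e f`.
[cite: IkenmeyerPanova2017, Lemma 2.7 (held: Lemma 14), proof] -/
theorem exists_forall_hasDetRepr_of_support_subset (S : Finset (σ →₀ ℕ)) :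
    ∃ C : ℕ, ∀ f : MvPolynomial σ k, f.support ⊆ S → HasDetRepr f C := by
  classical
  -- the generic polynomial with support `S`: one new variable `Y_e = X (inr e)` per monomial
  let F : MvPolynomial (σ ⊕ ↥S) k :=
    ∑ e ∈ S.attach, X (Sum.inr e) * rename Sum.inl (monomial (e : σ →₀ ℕ) 1)
  obtain ⟨C, A, hA, hdet⟩ := exists_hasDetRepr_holds F
  refine ⟨C, fun f hf => ?_⟩
  -- specialise `Y_e ↦ coeff_e f`, `X_i ↦ X_i`
  let a : σ ⊕ ↥S → MvPolynomial σ k :=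
    Sum.elim X fun e => MvPolynomial.C (coeff (e : σ →₀ ℕ) f)
  have ha : ∀ i, (a i).totalDegree ≤ 1 := by
    rintro (i | e)
    · -- a variable has total degree `≤ 1` (cf. `DepthReduction.totalDegree_X_le`)
      simpa [a, X, Finsupp.sum_single_index] using
        totalDegree_monomial_le (R := k) (Finsupp.single i 1) 1
    · simp only [a, Sum.elim_inr, totalDegree_C]
      exact Nat.zero_le _
  have hF : aeval a F = f := by
    simp only [F, map_sum, map_mul, aeval_X, aeval_rename]
    have h1 : (a ∘ Sum.inl : σ → MvPolynomial σ k) = X := funext fun i => rfl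
    simp only [h1, aeval_X_left, AlgHom.coe_id, id_eq, a, Sum.elim_inr, C_mul_monomial, mul_one]
    rw [Finset.sum_attach S fun e => monomial e (coeff e f),
      ← eq_sum_monomial_coeff_of_support_subset hf]
  refine ⟨(aeval a).mapMatrix A, fun i j => ?_, ?_⟩
  · rw [AlgHom.mapMatrix_apply, Matrix.map_apply]
    exact (HasDetRepr.totalDegree_aeval_le_of_le_one a ha _).trans (hA i j)
  · rw [← AlgHom.map_det, hdet, hF]

/-- The uniform bound in terms of determinantal complexity: `dc f ≤ C(S)` for every `f` with
support in `S`. [cite: IkenmeyerPanova2017, Lemma 2.7 (held: Lemma 14), proof] -/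
theorem exists_forall_determinantalComplexity_le_of_support_subset (S : Finset (σ →₀ ℕ)) :
    ∃ C : ℕ, ∀ f : MvPolynomial σ k, f.support ⊆ S → determinantalComplexity f ≤ C := by
  obtain ⟨C, hC⟩ := exists_forall_hasDetRepr_of_support_subset (k := k) S
  exact ⟨C, fun f hf => determinantalComplexity_le_of_hasDetRepr (hC f hf)⟩

/-- The support of a form of degree `m` in finitely many variables lies in the finset of
monomials of degree `m` (Mathlib's `Finset.univ.finsuppAntidiag m`, the tree's
`degMonomials σ m` of `OrbitCoordinateRing.lean`). [folklore] -/
theorem support_subset_finsuppAntidiag_of_isHomogeneous [Fintype σ] [DecidableEq σ] {m : ℕ}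
    {f : MvPolynomial σ k} (hf : f.IsHomogeneous m) :
    f.support ⊆ (Finset.univ : Finset σ).finsuppAntidiag m := by
  intro e he
  rw [Finset.mem_finsuppAntidiag]
  refine ⟨?_, Finset.subset_univ _⟩
  have h := hf (mem_support_iff.1 he)
  rw [← h, Finsupp.weight_apply, Finsupp.sum_fintype]
  · simp
  · intro i
    simp

/-- **IP Lemma 2.7 (held: Lemma 14), for every finite set of variables and every commutative
ring: the determinantal complexity is uniformly bounded on the forms of a fixed degree.** "Fix
`m ∈ ℕ`. There is a number `dcmax(m) ∈ ℕ` such that for all `f ∈ V_m` we have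
`dc(f) ≤ dcmax(m)`" (`V_m` = forms of degree `m`; in print `V_m = Sym^m ℂ^{m²}`, i.e.
`σ = MatIdx m`, `k = ℂ`). [cite: IkenmeyerPanova2017, Lemma 2.7 (held: Lemma 14)] -/
theorem exists_forall_determinantalComplexity_le_of_isHomogeneous [Fintype σ] (m : ℕ) :
    ∃ C : ℕ, ∀ f : MvPolynomial σ k, f.IsHomogeneous m → determinantalComplexity f ≤ C := by
  classical
  obtain ⟨C, hC⟩ := exists_forall_determinantalComplexity_le_of_support_subset (k := k)
    ((Finset.univ : Finset σ).finsuppAntidiag m)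
  exact ⟨C, fun f hf => hC f (support_subset_finsuppAntidiag_of_isHomogeneous hf)⟩

/-- The same in `HasDetRepr` form: one size `C` of affine determinantal representation serves all
forms of degree `m`. [cite: IkenmeyerPanova2017, Lemma 2.7 (held: Lemma 14)] -/
theorem exists_forall_hasDetRepr_of_isHomogeneous [Fintype σ] (m : ℕ) :
    ∃ C : ℕ, ∀ f : MvPolynomial σ k, f.IsHomogeneous m → HasDetRepr f C := by
  classical
  obtain ⟨C, hC⟩ := exists_forall_hasDetRepr_of_support_subset (k := k)
    ((Finset.univ : Finset σ).finsuppAntidiag m)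
  exact ⟨C, fun f hf => hC f (support_subset_finsuppAntidiag_of_isHomogeneous hf)⟩

end Uniform

end Literature.Computability.AlgebraicComplexity
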